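import Summits.Ventures.PercRepro.GenQTraceEightNumA
import Summits.Ventures.PercRepro.GenQTraceEightNumB
import Summits.Ventures.PercRepro.GenQTraceEightNumC
import Summits.Ventures.PercRepro.GenQTraceEightNumD
import Summits.Ventures.PercRepro.GenQTraceEightNumE
import Summits.Ventures.PercRepro.GenQTraceEightNumF
import Summits.Ventures.PercRepro.GenQTraceSevenAll

/-!
# PercRepro — `TraceSumsCore 7` REDUCED TO ITS CERTIFICATE RESIDUE (night-4, gen 18; the `(10, 8)` cell)

`lbSumT_seven_nonneg`: `0 ≤ lbSumT 7 fCore t n` for `1 ≤ t ≤ 7`, `n ≤ 87`, `n ≥ traceSevenBound t = 30 / 30 / 32 / 34 /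
38 / 47 / 83` (the 322 lemmas of `GenQTraceEightNumA … F`).  `TraceSevenResidue` is the level-`8` trace sum on the
rank-`7` subsets `H` of the core of a rank-`10` Core matroid at `7 + t ≤ |H| < traceSevenBound t` (coranks
`t … 22 / 22 / 24 / 26 / 30 / 39 / 75` at `t = 1 … 7`: `217` cases); `traceSumsCore_seven_of_residue : TraceSevenResidue →
TraceSumsCore 7` (type `0` outright, coranks `≤ t − 1` by `traceSum_nonneg_of_card_le'`, `|H| ≥ traceSevenBound t` by
TRACE LARGE on `|H| ≤ 87`).  Imports `GenQTraceEightNumA … F`, `GenQTraceSevenAll` (`core_flat_four_le_ten`).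
-/
namespace PercRepro.Night4

open Finset ThmH SixFour GenQ PerFlat Star NightThree ThmN

variable {α : Type} [DecidableEq α] {M : Matroid α} [M.Finite]

/-- **The trace numerics at level `8`**: `0 ≤ lbSumT 7 fCore t n` for `1 ≤ t ≤ 7`, `traceSevenBound t ≤ n ≤ 87`. -/
theorem lbSumT_seven_nonneg {t n : ℕ} (ht1 : 1 ≤ t) (ht : t ≤ 7) (hn : traceSevenBound t ≤ n) (h87 : n ≤ 87) :
    0 ≤ lbSumT 7 fCore t n := by
  unfold traceSevenBound at hn
  interval_cases t
  · norm_num at hn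
    exact lbSumT_seven_nonneg_1 hn h87
  · norm_num at hn
    exact lbSumT_seven_nonneg_2 hn h87
  · norm_num at hn
    exact lbSumT_seven_nonneg_3 hn h87
  · norm_num at hn
    exact lbSumT_seven_nonneg_4 hn h87
  · norm_num at hn
    exact lbSumT_seven_nonneg_5 hn h87
  · norm_num at hn
    exact lbSumT_seven_nonneg_6 hn h87
  · norm_num at hn
    exact lbSumT_seven_nonneg_7 hn h87

/-- **The certificate residue of `TraceSumsCore 7`**: the level-`8` trace sum on the rank-`7` subsets `H` of the core
of a rank-`10` Core matroid at `7 + t ≤ |H| < traceSevenBound t`, `1 ≤ t ≤ 7` — exactly what TRACE LARGE and the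
small-corank lemma do not cover. -/
def TraceSevenResidue : Prop :=
  ∀ {β : Type} [DecidableEq β] (M : Matroid β) [M.Finite] (H : Finset β), Core M 10 → H ⊆ gr M →
    M.eRk (H : Set β) = ((7 : ℕ) : ℕ∞) → ∀ t, 1 ≤ t → t ≤ 7 → 7 + t ≤ H.card → H.card < traceSevenBound t →
      0 ≤ ∑ B ∈ Rq M H 7, ((((7 + 1 : ℕ) : ℚ) + 2 - t) * (1 / (2 + (mTr M B : ℚ))) -
        ((((7 + 1 : ℕ) : ℚ) + 2) / (((7 + 1 : ℕ) : ℚ) + 1)) * GenQ.dem M H t B)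

/-- **`TraceSumsCore 7` from its certificate residue.** -/
theorem traceSumsCore_seven_of_residue (h : TraceSevenResidue) : TraceSumsCore 7 := by
  intro β _ M _ H hc hH hrH t ht
  have h10 := core_flat_four_le_ten M hc
  by_cases ht0 : t = 0
  · subst ht0
    exact traceSum_nonneg_of_t_zero hH
  · by_cases hsmall : H.card ≤ 7 + (t - 1)
    · exact traceSum_nonneg_of_card_le' (by omega) (by omega) hsmall
    · by_cases hres : H.card < traceSevenBound t
      · exact h M H hc hH hrH t (by omega) ht (by omega) hres
      · have h87 : H.card ≤ 87 :=
          sizeChain_core hc h10 8 H hH 7 (by norm_num) (le_of_eq hrH)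
        exact traceSum_nonneg_of_lbSumT_core hc h10 (by norm_num) hH hrH (by omega)
          (lbSumT_seven_nonneg (by omega) ht (by omega) h87)

end PercRepro.Night4
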